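import Mathlib
import HarnessLib
import Summits.ValiantsHypothesis.ValiantsHypothesis.Theorems.LacunarySymmetroidMatrixDescartesProductPlusOneRiccati
import Summits.ValiantsHypothesis.ValiantsHypothesis.Theorems.LacunarySymmetroidMatrixDescartesProductPlusOneOneRiserSeparation

/-!
# LINE (A) `product_plus_one` — the one-riser interaction lemma in the LINE's currency (`eulerNumerator d a 0`, K = 3)

Memo `pub/val-lit/lmr/NOTE-p7g15-18050-LINEA-incoherent-cell.md` §9 (crux item stmt-ValiantsHypothesis-18050, LINE (A) floor structure,
registered floor stub `OneChangeFloorK3`).  Support `d 0 < d 1 < d 2`, rows `a : Fin m → Fin 3 → ℝ`, bottom coupling `l₀ = 0`, the c-free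
Euler numerator `R = Σ_j (Σ_l a_{jl}(d_l − d_0) X^{d_l}) ∏_{i ≠ j} f_i` (= `eulerNumerator d a 0` of the LINE file, by `rfl`).
Member of the class: ONE incoherent trinomial RISER row `j₀` with `a_{j₀ 1} < 0`, `a_{j₀ 2} < 0` (bottom letter free) and binomial PULLER
rows `j ≠ j₀` with `a_{j0} > 0 > a_{j1}`, `a_{j2} = 0` (rows may be negated freely: `R ↦ ±R`).

* `fin3_support_eq_gaps`, `riser_eulerRatio_eq`, `puller_eulerRatio_eq` — bookkeeping: the support through its gaps, and the two Euler
  ratios in the analytic currency of `…OneRiserSeparation` (`Y = x^{d₁−d₀}`; a puller's ratio is `−p·Y/(z_j − Y)`, `z_j = a_{j0}/(−a_{j1})`,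
  i.e. weight `1` in `momentS`);
* `oneRiser_eulerSum_eq` — on an interval where the riser is negative and the pullers positive,
  `Σ_j Φ_j(x) = (p b Y + q c x^q)/(b Y + c x^q − a_{j₀0}) − p·Y·S₁(Y)` (`b = −a_{j₀1}`, `c = −a_{j₀2}`);
* `oneSigned_eulerNumerator_no_four_zeros` (appended) — the same count for ONE one-signed trinomial row `(−,−,−)` against binomial pullers on
  `(0, t_min)`: its «0 → 1 → r double rise» costs at most one extra pair;
* ★★ `oneRiser_eulerNumerator_no_four_zeros` — on a pole-free interval `[x₁, x₄] ⊂ (0, ∞)` where the riser is SWITCHED (`f_{j₀} < 0`) and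
  every puller UNSWITCHED (`f_j(x₄) > 0`), `R` does not vanish at four points `x₁ < x₂ < x₃ < x₄`: AT MOST THREE zeros per such interval,
  uniformly in the support, in `m` and in all coefficients (✓ `oneRiser_no_four_zeros` through ✓ `eval_eulerNumerator_eq_prod_mul_sum`).

Honest framing: a located STRUCTURE lemma of the research floor — one riser against a binomial cloud on one interval; the floor's open core
(pullers with a top letter, several risers, T1 risers, T4 rows) is untouched; NOT `OneChangeFloorK3` / `stub_classRowK3` / `stub_polyLaw` /
`MatrixDescartes` / B; `VP ≠ VNP` NOT proved.  No definitions, no named facts; Mathlib only.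
-/

set_option linter.dupNamespace false

namespace Summit.ValiantsHypothesis.ValiantsHypothesis.Theorems.LacunarySymmetroidMatrixDescartes

namespace ProductPlusOne

open Finset Polynomial
open scoped BigOperators Polynomial

/-- A support `d 0 < d 1 < d 2` written through its gaps `e₁ + 1`, `e₂ + 1`. -/
theorem fin3_support_eq_gaps (d : Fin 3 → ℕ) (e₁ e₂ : ℕ) (h1 : d 1 = d 0 + e₁ + 1) (h2 : d 2 = d 1 + e₂ + 1) :
    (![d 0, d 0 + (e₁ + 1), d 0 + (e₁ + e₂ + 2)] : Fin 3 → ℕ) = d := by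
  funext l
  fin_cases l
  · rfl
  · show d 0 + (e₁ + 1) = d 1; omega
  · show d 0 + (e₁ + e₂ + 2) = d 2; omega

/-- The riser's Euler ratio in analytic currency: `(p a₁ x^{d₀+p} + q a₂ x^{d₀+q})/(a₀x^{d₀} + a₁x^{d₀+p} + a₂x^{d₀+q})
 = (p b x^p + q c x^q)/(b x^p + c x^q − a₀)` with `b = −a₁`, `c = −a₂` (factor nonzero at `x > 0`). -/
theorem riser_eulerRatio_eq (d0 p q : ℕ) (pR qR a0 a1 a2 : ℝ) {x : ℝ} (hx : 0 < x)
    (hf : a0 + a1 * x ^ p + a2 * x ^ q ≠ 0) :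
    (pR * a1 * x ^ (d0 + p) + qR * a2 * x ^ (d0 + q)) / (a0 * x ^ d0 + a1 * x ^ (d0 + p) + a2 * x ^ (d0 + q))
      = (pR * (-a1) * x ^ p + qR * (-a2) * x ^ q) / ((-a1) * x ^ p + (-a2) * x ^ q - a0) := by
  have hxd : x ^ d0 ≠ 0 := pow_ne_zero _ hx.ne'
  have hden1 : a0 * x ^ d0 + a1 * x ^ (d0 + p) + a2 * x ^ (d0 + q) ≠ 0 := by
    have : a0 * x ^ d0 + a1 * x ^ (d0 + p) + a2 * x ^ (d0 + q) = x ^ d0 * (a0 + a1 * x ^ p + a2 * x ^ q) := by ring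
    rw [this]; exact mul_ne_zero hxd hf
  have hden2 : (-a1) * x ^ p + (-a2) * x ^ q - a0 ≠ 0 := by
    have : (-a1) * x ^ p + (-a2) * x ^ q - a0 = -(a0 + a1 * x ^ p + a2 * x ^ q) := by ring
    rw [this]; exact neg_ne_zero.2 hf
  rw [div_eq_div_iff hden1 hden2]
  ring

/-- A binomial puller's Euler ratio in analytic currency: `p a₁ x^{d₀+p}/(a₀ x^{d₀} + a₁ x^{d₀+p}) = −p·Y·(1/(z − Y)^1)` with `Y = x^p`,
`z = a₀/(−a₁)` (`a₁ < 0`, factor positive). -/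
theorem puller_eulerRatio_eq (d0 p : ℕ) (pR a0 a1 : ℝ) {x : ℝ} (hx : 0 < x) (ha1 : a1 < 0) (hpos : 0 < a0 + a1 * x ^ p) :
    (pR * a1 * x ^ (d0 + p) + 0) / (a0 * x ^ d0 + a1 * x ^ (d0 + p) + 0)
      = -(pR * x ^ p * (1 / (a0 / (-a1) - x ^ p) ^ 1)) := by
  have hxd : x ^ d0 ≠ 0 := pow_ne_zero _ hx.ne'
  have ha1' : -a1 ≠ 0 := by linarith
  have ha1ne : a1 ≠ 0 := ha1.ne
  have hz : a0 / (-a1) - x ^ p = (a0 + a1 * x ^ p) / (-a1) := by field_simp; ring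
  have hden1 : a0 * x ^ d0 + a1 * x ^ (d0 + p) + 0 ≠ 0 := by
    have : a0 * x ^ d0 + a1 * x ^ (d0 + p) + 0 = x ^ d0 * (a0 + a1 * x ^ p) := by ring
    rw [this]; exact mul_ne_zero hxd hpos.ne'
  rw [pow_one, hz, one_div_div, add_zero, add_zero]
  rw [add_zero] at hden1
  have hpos' : a0 + a1 * x ^ p ≠ 0 := hpos.ne'
  field_simp
  ring

/-- **The total Euler ratio of a one-riser member**, on an interval where the riser is negative and every puller positive:
`Σ_j Φ_j(x) = (p b Y + q c x^q)/(b Y + c x^q − a_{j₀0}) − p·Y·S₁(Y)` with `Y = x^p`, `b = −a_{j₀1}`, `c = −a_{j₀2}`, weights `1` and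
poles `z_j = a_{j0}/(−a_{j1})` over `univ.erase j₀`. -/
theorem oneRiser_eulerSum_eq {m : ℕ} (d : Fin 3 → ℕ) (e₁ e₂ : ℕ) (he₁ : d 1 = d 0 + e₁ + 1) (he₂ : d 2 = d 1 + e₂ + 1)
    (a : Fin m → Fin 3 → ℝ) (j₀ : Fin m) (hpul : ∀ j, j ≠ j₀ → a j 1 < 0 ∧ a j 2 = 0) {x : ℝ} (hx : 0 < x)
    (hr : a j₀ 0 + a j₀ 1 * x ^ (e₁ + 1) + a j₀ 2 * x ^ (e₁ + e₂ + 2) ≠ 0)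
    (hp : ∀ j, j ≠ j₀ → 0 < a j 0 + a j 1 * x ^ (e₁ + 1)) :
    ∑ j, (X * derivative (∑ l, C (a j l) * X ^ (d l) : ℝ[X]) - C ((d 0 : ℕ) : ℝ) * ∑ l, C (a j l) * X ^ (d l)).eval x
        / (∑ l, C (a j l) * X ^ (d l) : ℝ[X]).eval x
      = (((e₁ : ℝ) + 1) * (-(a j₀ 1)) * x ^ (e₁ + 1) + ((e₁ : ℝ) + e₂ + 2) * (-(a j₀ 2)) * x ^ (e₁ + e₂ + 2))
            / ((-(a j₀ 1)) * x ^ (e₁ + 1) + (-(a j₀ 2)) * x ^ (e₁ + e₂ + 2) - a j₀ 0)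
          - ((e₁ : ℝ) + 1) * x ^ (e₁ + 1)
              * momentS (Finset.univ.erase j₀) (fun _ => (1 : ℝ)) (fun j => a j 0 / (-(a j 1))) 1 (x ^ (e₁ + 1)) := by
  classical
  have hd := fin3_support_eq_gaps d e₁ e₂ he₁ he₂
  have hev : ∀ j, (∑ l, C (a j l) * X ^ (d l) : ℝ[X]).eval x
        = a j 0 * x ^ (d 0) + a j 1 * x ^ (d 0 + (e₁ + 1)) + a j 2 * x ^ (d 0 + (e₁ + e₂ + 2)) ∧
      (X * derivative (∑ l, C (a j l) * X ^ (d l) : ℝ[X]) - C ((d 0 : ℕ) : ℝ) * ∑ l, C (a j l) * X ^ (d l)).eval x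
        = ((e₁ + 1 : ℕ) : ℝ) * a j 1 * x ^ (d 0 + (e₁ + 1)) + ((e₁ + e₂ + 2 : ℕ) : ℝ) * a j 2 * x ^ (d 0 + (e₁ + e₂ + 2)) := by
    intro j
    have h := eval_trinomial_three (d 0) (e₁ + 1) (e₁ + e₂ + 2) (a j) x
    rw [hd] at h
    exact h
  rw [← Finset.add_sum_erase _ _ (Finset.mem_univ j₀)]
  congr 1
  · rw [(hev j₀).1, (hev j₀).2, riser_eulerRatio_eq (d 0) (e₁ + 1) (e₁ + e₂ + 2) _ _ (a j₀ 0) (a j₀ 1) (a j₀ 2) hx hr]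
    push_cast
    ring_nf
  · rw [momentS_def, Finset.mul_sum, ← Finset.sum_neg_distrib]
    refine Finset.sum_congr rfl fun j hj => ?_
    have hj' : j ≠ j₀ := Finset.ne_of_mem_erase hj
    obtain ⟨h1, h2⟩ := hpul j hj'
    rw [(hev j).1, (hev j).2, h2, zero_mul, mul_zero, zero_mul,
      puller_eulerRatio_eq (d 0) (e₁ + 1) _ (a j 0) (a j 1) hx h1 (hp j hj')]
    push_cast
    ring

/-- ★★ **ONE-RISER INTERACTION LEMMA, LINE currency (K = 3, bottom coupling).**  Support `d 0 < d 1 < d 2`; riser row `j₀` with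
`a_{j₀1} < 0`, `a_{j₀2} < 0`; puller rows `j ≠ j₀` with `a_{j0} > 0 > a_{j1}`, `a_{j2} = 0`.  On an interval `[x₁, x₄] ⊂ (0,∞)` where the
riser is switched (`f_{j₀} < 0`) and every puller unswitched (`f_j(x₄) > 0`), the c-free Euler numerator `eulerNumerator d a 0` does NOT
vanish at four points `x₁ < x₂ < x₃ < x₄`.  [this file's theorem] -/
theorem oneRiser_eulerNumerator_no_four_zeros {m : ℕ} (d : Fin 3 → ℕ) (h01 : d 0 < d 1) (h12 : d 1 < d 2)
    (a : Fin m → Fin 3 → ℝ) (j₀ : Fin m) (hr1 : a j₀ 1 < 0) (hr2 : a j₀ 2 < 0)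
    (hpul : ∀ j, j ≠ j₀ → 0 < a j 0 ∧ a j 1 < 0 ∧ a j 2 = 0)
    {x₁ x₂ x₃ x₄ : ℝ} (h0 : 0 < x₁) (h12' : x₁ < x₂) (h23 : x₂ < x₃) (h34 : x₃ < x₄)
    (hsw : ∀ x ∈ Set.Icc x₁ x₄, (∑ l, C (a j₀ l) * X ^ (d l) : ℝ[X]).eval x < 0)
    (hun : ∀ j, j ≠ j₀ → 0 < (∑ l, C (a j l) * X ^ (d l) : ℝ[X]).eval x₄)
    (hzero : ∀ x ∈ ({x₁, x₂, x₃, x₄} : Set ℝ),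
      (∑ j, (∑ l, C (a j l * ((d l : ℝ) - d 0)) * X ^ (d l)) * ∏ i ∈ Finset.univ.erase j, (∑ l, C (a i l) * X ^ (d l))
        : ℝ[X]).eval x = 0) : False := by
  classical
  obtain ⟨e₁, he₁⟩ := Nat.exists_eq_add_of_lt h01
  obtain ⟨e₂, he₂⟩ := Nat.exists_eq_add_of_lt h12
  have hd := fin3_support_eq_gaps d e₁ e₂ he₁ he₂
  have hev : ∀ j x, (∑ l, C (a j l) * X ^ (d l) : ℝ[X]).eval x
        = a j 0 * x ^ (d 0) + a j 1 * x ^ (d 0 + (e₁ + 1)) + a j 2 * x ^ (d 0 + (e₁ + e₂ + 2)) := by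
    intro j x
    have h := (eval_trinomial_three (d 0) (e₁ + 1) (e₁ + e₂ + 2) (a j) x).1
    rw [hd] at h
    exact h
  have h14 : x₁ < x₄ := by linarith
  -- membership of the four points in the interval
  have hIcc : ∀ x ∈ ({x₁, x₂, x₃, x₄} : Set ℝ), x ∈ Set.Icc x₁ x₄ := by
    intro x hx
    simp only [Set.mem_insert_iff, Set.mem_singleton_iff] at hx
    rcases hx with h | h | h | h <;> (subst h; constructor <;> linarith)
  -- the riser is switched, the pullers unswitched, on the whole interval
  have hsw' : ∀ x ∈ Set.Icc x₁ x₄, a j₀ 0 < (-(a j₀ 1)) * x ^ (e₁ + 1) + (-(a j₀ 2)) * x ^ (e₁ + e₂ + 2) := by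
    intro x hx
    have hx0 : 0 < x := h0.trans_le hx.1
    have h := hsw x hx
    rw [hev] at h
    have hfac : a j₀ 0 * x ^ (d 0) + a j₀ 1 * x ^ (d 0 + (e₁ + 1)) + a j₀ 2 * x ^ (d 0 + (e₁ + e₂ + 2))
        = x ^ (d 0) * (a j₀ 0 + a j₀ 1 * x ^ (e₁ + 1) + a j₀ 2 * x ^ (e₁ + e₂ + 2)) := by ring
    rw [hfac] at h
    have hxd : 0 < x ^ (d 0) := pow_pos hx0 _
    have := (mul_neg_iff.1 h).resolve_right (fun h' => absurd hxd (not_lt.2 h'.1.le))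
    linarith [this.2]
  have hp' : ∀ x ∈ Set.Icc x₁ x₄, ∀ j, j ≠ j₀ → 0 < a j 0 + a j 1 * x ^ (e₁ + 1) := by
    intro x hx j hj
    have hx0 : 0 < x := h0.trans_le hx.1
    obtain ⟨_, h1, h2⟩ := hpul j hj
    have h := hun j hj
    rw [hev, h2, zero_mul, add_zero] at h
    have hfac : a j 0 * x₄ ^ (d 0) + a j 1 * x₄ ^ (d 0 + (e₁ + 1)) = x₄ ^ (d 0) * (a j 0 + a j 1 * x₄ ^ (e₁ + 1)) := by ring
    rw [hfac] at h
    have hx4 : 0 < x₄ ^ (d 0) := pow_pos (h0.trans h14) _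
    have h4 : 0 < a j 0 + a j 1 * x₄ ^ (e₁ + 1) := (mul_pos_iff_of_pos_left hx4).1 h
    have hmono : a j 1 * x₄ ^ (e₁ + 1) ≤ a j 1 * x ^ (e₁ + 1) :=
      mul_le_mul_of_nonpos_left (pow_le_pow_left₀ hx0.le hx.2 _) h1.le
    linarith
  have hun' : ∀ i ∈ Finset.univ.erase j₀, x₄ ^ (e₁ + 1) < (fun j => a j 0 / (-(a j 1))) i := by
    intro i hi
    have hi' : i ≠ j₀ := Finset.ne_of_mem_erase hi
    obtain ⟨_, h1, _⟩ := hpul i hi'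
    have h4 := hp' x₄ ⟨h14.le, le_rfl⟩ i hi'
    show x₄ ^ (e₁ + 1) < a i 0 / (-(a i 1))
    rw [lt_div_iff₀ (by linarith)]
    linarith
  -- no factor vanishes on the interval
  have hf : ∀ x ∈ Set.Icc x₁ x₄, ∀ j, (∑ l, C (a j l) * X ^ (d l) : ℝ[X]).eval x ≠ 0 := by
    intro x hx j
    by_cases hj : j = j₀
    · subst hj; exact (hsw x hx).ne
    · have hx0 : 0 < x := h0.trans_le hx.1
      obtain ⟨_, _, h2⟩ := hpul j hj
      rw [hev, h2, zero_mul, add_zero]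
      have hfac : a j 0 * x ^ (d 0) + a j 1 * x ^ (d 0 + (e₁ + 1)) = x ^ (d 0) * (a j 0 + a j 1 * x ^ (e₁ + 1)) := by ring
      rw [hfac]
      exact mul_ne_zero (pow_ne_zero _ hx0.ne') (hp' x hx j hj).ne'
  have hr' : ∀ x ∈ Set.Icc x₁ x₄, a j₀ 0 + a j₀ 1 * x ^ (e₁ + 1) + a j₀ 2 * x ^ (e₁ + e₂ + 2) ≠ 0 := by
    intro x hx; have := hsw' x hx; linarith
  -- at the four points the total Euler ratio vanishes
  have hzero' : ∀ x ∈ ({x₁, x₂, x₃, x₄} : Set ℝ),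
      (((e₁ : ℝ) + 1) * (-(a j₀ 1)) * x ^ (e₁ + 1) + ((e₁ : ℝ) + e₂ + 2) * (-(a j₀ 2)) * x ^ (e₁ + e₂ + 2))
          / ((-(a j₀ 1)) * x ^ (e₁ + 1) + (-(a j₀ 2)) * x ^ (e₁ + e₂ + 2) - a j₀ 0)
        - ((e₁ : ℝ) + 1) * x ^ (e₁ + 1)
            * momentS (Finset.univ.erase j₀) (fun _ => (1 : ℝ)) (fun j => a j 0 / (-(a j 1))) 1 (x ^ (e₁ + 1)) = 0 := by
    intro x hx
    have hxI := hIcc x hx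
    have hx0 : 0 < x := h0.trans_le hxI.1
    rw [← oneRiser_eulerSum_eq d e₁ e₂ he₁ he₂ a j₀ (fun j hj => ⟨(hpul j hj).2.1, (hpul j hj).2.2⟩) hx0 (hr' x hxI)
      (hp' x hxI)]
    have h := hzero x hx
    rw [eval_eulerNumerator_eq_prod_mul_sum d a 0 (hf x hxI)] at h
    exact (mul_eq_zero.1 h).resolve_left (Finset.prod_ne_zero_iff.2 fun j _ => hf x hxI j)
  -- with or without pullers
  rcases (Finset.univ.erase j₀).eq_empty_or_nonempty with hs | hs
  · -- no pullers: the total ratio is the riser's, which is positive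
    have h := hzero' x₁ (by simp)
    have hx0 : 0 < x₁ := h0
    rw [hs, momentS_def, Finset.sum_empty, mul_zero, sub_zero] at h
    have hden : 0 < (-(a j₀ 1)) * x₁ ^ (e₁ + 1) + (-(a j₀ 2)) * x₁ ^ (e₁ + e₂ + 2) - a j₀ 0 := by
      linarith [hsw' x₁ ⟨le_rfl, h14.le⟩]
    have hnum : 0 < ((e₁ : ℝ) + 1) * (-(a j₀ 1)) * x₁ ^ (e₁ + 1) + ((e₁ : ℝ) + e₂ + 2) * (-(a j₀ 2)) * x₁ ^ (e₁ + e₂ + 2) := by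
      have hb : 0 < -(a j₀ 1) := by linarith
      have hc : 0 < -(a j₀ 2) := by linarith
      positivity
    exact absurd h (div_pos hnum hden).ne'
  · exact oneRiser_no_four_zeros hs (fun _ _ => one_pos) e₁ e₂ (b := -(a j₀ 1)) (c := -(a j₀ 2)) (by linarith) (by linarith)
      h0 h12' h23 h34 hsw' hun' hzero'

/-- ★ **ONE ONE-SIGNED ROW against binomial pullers — the «0 → 1 → r double rise» costs at most one extra pair.**  Support `d 0 < d 1 < d 2`;
row `j₀` ONE-SIGNED with all letters negative (`(+,+,+)` negated — negating a row only flips the sign of `R`); puller rows `j ≠ j₀` with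
`a_{j0} > 0 > a_{j1}`, `a_{j2} = 0`, all unswitched at `x₄` (`f_j(x₄) > 0`).  Then `eulerNumerator d a 0` does not vanish at four points
`0 < x₁ < x₂ < x₃ < x₄`: at most THREE zeros on `(0, t_min)`.  (Instance of `oneRiser_eulerNumerator_no_four_zeros`: the riser's bottom letter is
free there and a one-signed row is «switched» everywhere.) [this file's corollary] -/
theorem oneSigned_eulerNumerator_no_four_zeros {m : ℕ} (d : Fin 3 → ℕ) (h01 : d 0 < d 1) (h12 : d 1 < d 2)
    (a : Fin m → Fin 3 → ℝ) (j₀ : Fin m) (hr0 : a j₀ 0 < 0) (hr1 : a j₀ 1 < 0) (hr2 : a j₀ 2 < 0)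
    (hpul : ∀ j, j ≠ j₀ → 0 < a j 0 ∧ a j 1 < 0 ∧ a j 2 = 0)
    {x₁ x₂ x₃ x₄ : ℝ} (h0 : 0 < x₁) (h12' : x₁ < x₂) (h23 : x₂ < x₃) (h34 : x₃ < x₄)
    (hun : ∀ j, j ≠ j₀ → 0 < (∑ l, C (a j l) * X ^ (d l) : ℝ[X]).eval x₄)
    (hzero : ∀ x ∈ ({x₁, x₂, x₃, x₄} : Set ℝ),
      (∑ j, (∑ l, C (a j l * ((d l : ℝ) - d 0)) * X ^ (d l)) * ∏ i ∈ Finset.univ.erase j, (∑ l, C (a i l) * X ^ (d l))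
        : ℝ[X]).eval x = 0) : False := by
  refine oneRiser_eulerNumerator_no_four_zeros d h01 h12 a j₀ hr1 hr2 hpul h0 h12' h23 h34 (fun x hx => ?_) hun hzero
  -- a one-signed negative row is negative at every `x > 0`
  have hx0 : 0 < x := h0.trans_le hx.1
  rw [eval_finsetSum]
  refine Finset.sum_neg (fun l _ => ?_) Finset.univ_nonempty
  rw [eval_mul, eval_C, eval_pow, eval_X]
  have hxl : 0 < x ^ (d l) := pow_pos hx0 _
  have hal : a j₀ l < 0 := by fin_cases l <;> assumption
  exact mul_neg_of_neg_of_pos hal hxl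

end ProductPlusOne

end Summit.ValiantsHypothesis.ValiantsHypothesis.Theorems.LacunarySymmetroidMatrixDescartes
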